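import Summits.CriticalPhenomena.PercolationContinuityZ3.Theorems.PercNearOneGluingAdditiveGluingSigmaRecursion
import Summits.CriticalPhenomena.PercolationContinuityZ3.Theorems.PercNearOneGluingAdditiveGluingSigmaGeometry
import Summits.CriticalPhenomena.PercolationContinuityZ3.Theorems.PercNearOneGluingAdditiveGluingSigmaLaw
import HarnessLib

/-! # Crux `PercNearOneGluing.AdditiveGluing` (stmt-CriticalPhenomena-4576), line `peel` (skeleton v7, whole-block
# route), stub `stub_wholeBlockReach_c5` — the whole-block σ-identity R (law of total probability over the layer of
# the glued block)

Support file (`--supports stmt-CriticalPhenomena-4576`); no definitions, no named facts.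

`μ_{u/S} = prodBernoulli (u/S)` is bond percolation on `Fin n` with the block `S` glued
(`(u/S) e = if (∀ y ∈ e, y ∈ S) ∧ ¬ e.IsDiag then 1 else u e`), `b ∉ S` a target.  Partition the event
"the block `S` reaches `b`" by the layer `N` = the set of vertices outside `S` joined to `S` by an open edge (the
layer event `L_N = {ω | ∀ y, y ∈ N ↔ (y ∉ S ∧ ∃ o ∈ S, s(o, y) ∈ ω)}` of `stub_sigmaLaw` with `O = S`):
`μ_{u/S}(S ↔ b) = Σ_N μ_{u/S}(L_N) · μ_{q_N}(N ↔ b)`, where `q_N` is `u` with every star of `S` killed and the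
pairs inside `N` glued.  Proof: `sigmaRec_partition` (partition by the layer); on `L_N` and the clique event
`K = {ω | all non-loop pairs inside S are open}` (conull under `u/S`: those pairs have weight `1`, `sigmaRec_conull`),
`S ↔ b` in `ω` iff `N ↔ b` in `Ψ_N ω = {e ∈ ω | e avoids S} ∪ {non-loop pairs inside N}` (`stub_sigmaGeometry` with
`O = S`, `X = {b}`); replace the event inside the conull `K` (`sigmaRec_inter_congr`) and factor (`stub_sigmaLaw`
with `O = S`).
[cite: KozmaNitzan2024, §3.2 pp. 13–14 (the `σ_B`-decomposition, proofs of Thms 4–5)]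
-/

namespace Summit.CriticalPhenomena.PercolationContinuityZ3.Theorems

open MeasureTheory Set
open Literature.Probability.LatticeModels (prodBernoulli)
open Literature.Probability.Percolation (BondConfig openConn openGraph)
open scoped BigOperators Classical

noncomputable section

section WholeBlockReach

variable {n : ℕ}

/-- **Pointwise geometry of the whole-block layer.**  If `N` is exactly the set of vertices outside `S` joined to
`S` by an open edge of `ω` (`b ∉ S`) and all non-loop pairs inside `S` are open in `ω`, then `S` reaches `b` in
`ω` iff `N` reaches `b` in the glued off-block configuration
`Ψ_N ω = {e ∈ ω | e avoids S} ∪ {non-loop pairs inside N}` (`stub_sigmaGeometry` with `O = S`, `X = {b}`).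
[cite: KozmaNitzan2024, §3.2 p. 14] -/
theorem wholeR_geometry (S N : Finset (Fin n)) (b : Fin n) (hbS : b ∉ S) (ω : BondConfig (Fin n))
    (hL : ∀ y : Fin n, y ∈ N ↔ (y ∉ S ∧ ∃ o ∈ S, s(o, y) ∈ ω))
    (hK : ∀ o ∈ S, ∀ o' ∈ S, o ≠ o' → s(o, o') ∈ ω) :
    ω ∈ (⋃ v ∈ S, openConn v b : Set (BondConfig (Fin n))) ↔
      ({e | e ∈ ω ∧ ∀ y ∈ e, y ∉ S} ∪ {e | (∀ y ∈ e, y ∈ N) ∧ ¬ e.IsDiag} : BondConfig (Fin n)) ∈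
        (⋃ v ∈ N, openConn v b : Set (BondConfig (Fin n))) := by
  have h := (stub_sigmaGeometry n S N ω hL hK).1 {b} (Finset.disjoint_singleton_right.2 hbS)
  simpa only [Finset.set_biUnion_singleton] using h

/-- **One layer of identity R.**  For `b ∉ S` and a layer value `N`,
`μ_{u/S}(L_N ∩ {S ↔ b}) = μ_{u/S}(L_N ∩ Ψ_N⁻¹{N ↔ b})`: the clique event "all non-loop pairs inside `S` are open"
is conull under `u/S` (weight `1` on those pairs, `sigmaRec_conull`), and on `L_N` and that event `S ↔ b` in `ω` iff
`N ↔ b` in `Ψ_N ω` (`wholeR_geometry`); swap the events inside the conull event (`sigmaRec_inter_congr`).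
[cite: KozmaNitzan2024, §3.2 p. 14] -/
theorem wholeR_layer_congr (u : Sym2 (Fin n) → unitInterval) (S N : Finset (Fin n)) (b : Fin n)
    (hbS : b ∉ S) :
    (prodBernoulli (fun e : Sym2 (Fin n) => if (∀ y ∈ e, y ∈ S) ∧ ¬ e.IsDiag then 1 else u e)).real
        ({ω : BondConfig (Fin n) | ∀ y : Fin n, y ∈ N ↔ (y ∉ S ∧ ∃ o ∈ S, s(o, y) ∈ ω)} ∩
          ⋃ v ∈ S, openConn v b) =
      (prodBernoulli (fun e : Sym2 (Fin n) => if (∀ y ∈ e, y ∈ S) ∧ ¬ e.IsDiag then 1 else u e)).real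
        ({ω : BondConfig (Fin n) | ∀ y : Fin n, y ∈ N ↔ (y ∉ S ∧ ∃ o ∈ S, s(o, y) ∈ ω)} ∩
          {ω : BondConfig (Fin n) |
            ({e | e ∈ ω ∧ ∀ y ∈ e, y ∉ S} ∪ {e | (∀ y ∈ e, y ∈ N) ∧ ¬ e.IsDiag} : BondConfig (Fin n)) ∈
              (⋃ v ∈ N, openConn v b : Set (BondConfig (Fin n)))}) := by
  -- the clique event of the glued block is conull: each non-loop pair inside `S` has weight `1`
  have hKc : prodBernoulli
      (fun e : Sym2 (Fin n) => if (∀ y ∈ e, y ∈ S) ∧ ¬ e.IsDiag then 1 else u e)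
      {ω : BondConfig (Fin n) | ∀ o ∈ S, ∀ o' ∈ S, o ≠ o' → s(o, o') ∈ ω}ᶜ = 0 := by
    refine sigmaRec_conull
      (fun e : Sym2 (Fin n) => if (∀ y ∈ e, y ∈ S) ∧ ¬ e.IsDiag then 1 else u e)
      {ω : BondConfig (Fin n) | ∀ o ∈ S, ∀ o' ∈ S, o ≠ o' → s(o, o') ∈ ω} fun ω hω => ?_
    simp only [Set.mem_setOf_eq] at hω
    push Not at hω
    obtain ⟨o, ho, o', ho', hne, hnot⟩ := hω
    refine ⟨s(o, o'), ?_, hnot⟩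
    show (if (∀ y ∈ s(o, o'), y ∈ S) ∧ ¬ (s(o, o')).IsDiag then (1 : unitInterval)
      else u s(o, o')) = 1
    rw [if_pos]
    refine ⟨fun y hy => ?_, fun hd => hne (Sym2.mk_isDiag_iff.1 hd)⟩
    rcases Sym2.mem_iff.1 hy with rfl | rfl
    · exact ho
    · exact ho'
  exact sigmaRec_inter_congr _ hKc fun ω hL hK => wholeR_geometry S N b hbS ω hL hK

end WholeBlockReach

/-- **σ-identity R (whole-block reach)** — registered stub `stub_wholeBlockReach_c5` of crux
stmt-CriticalPhenomena-4576 (line `peel`, skeleton v7, whole-block route): the law of total probability over the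
layer `N` of the glued block `S`,
`μ_{u/S}(S ↔ b) = Σ_N μ_{u/S}(layer of S = N) · μ_{q_N}(N ↔ b)` with `q_N` = `u` with every star of `S` killed
and `N` glued.  Partition by the layer (`sigmaRec_partition`), swap `{S ↔ b}` for `Ψ_N⁻¹{N ↔ b}` inside each layer
(`wholeR_layer_congr`: geometry part 1 with `X = {b}` on the conull clique event), factor (`stub_sigmaLaw` with
`O = S`).
[cite: KozmaNitzan2024, §3.2 pp. 13–14 (the `σ_B`-decomposition, proofs of Thms 4–5)] -/
theorem stub_wholeBlockReach_c5 :
    ∀ (n : ℕ) (u : Sym2 (Fin n) → unitInterval) (S : Finset (Fin n)) (b : Fin n), b ∉ S →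
      (prodBernoulli (fun e : Sym2 (Fin n) => if (∀ y ∈ e, y ∈ S) ∧ ¬ e.IsDiag then 1 else u e)).real (⋃ v ∈ S, openConn v b)
        = ∑ N : Finset (Fin n), (prodBernoulli (fun e : Sym2 (Fin n) => if (∀ y ∈ e, y ∈ S) ∧ ¬ e.IsDiag then 1 else u e)).real {ω : BondConfig (Fin n) | ∀ y : Fin n, y ∈ N ↔ (y ∉ S ∧ ∃ o ∈ S, s(o, y) ∈ ω)}
            * (prodBernoulli (fun e : Sym2 (Fin n) => if (∀ y ∈ e, y ∈ N) ∧ ¬ e.IsDiag then 1 else if (∃ y ∈ e, y ∈ S) then 0 else u e)).real (⋃ v ∈ N, openConn v b) := by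
  intro n u S b hbS
  rw [sigmaRec_partition
    (fun e : Sym2 (Fin n) => if (∀ y ∈ e, y ∈ S) ∧ ¬ e.IsDiag then 1 else u e) S
    (⋃ v ∈ S, openConn v b)]
  refine Finset.sum_congr rfl fun N _ => ?_
  rw [← stub_sigmaLaw n u S N (⋃ v ∈ N, openConn v b)]
  exact wholeR_layer_congr u S N b hbS

end

end Summit.CriticalPhenomena.PercolationContinuityZ3.Theorems
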